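import Mathlib
import Summits.Ventures.LatticeQCDFlow.Scaling.UniformJet
import Summits.Ventures.LatticeQCDFlow.Scaling.TiltedJet

/-!
# LatticeQCDFlow / Scaling — slab chains: the transfer kernel of one slab and integration of the
# vertical variables (files 2 of the slab-chain proof of (LC) at every separation)

HONEST FRAMING: exact (Metropolis-corrected) sampling algorithms for lattice gauge theory;
figures of merit are autocorrelation/cost numbers at stated couplings and volumes; no
continuum-physics claim.

Venture `LatticeQCDFlow` (cell pub-lqcd), topic `Scaling`, FANOUT row 30 (lean-1) — OUR WORK (LEAD
LINE 230 (G3′): the general-separation leading-coefficient identity (LC)).  The ABSTRACT SETTING of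
the whole proof, measure-theoretic and lattice-free: `L = n+1` HEIGHTS `h : Fin (n+1)` (cyclic,
`h + 1` taken in `Fin (n+1)`), a LAYER variable `η_h : E` at every height and a VERTICAL variable
`v_h : V` in every slab `{h, h+1}`, all independent (`Measure.pi`), and a tilt by the total cost
`C(η, v) = Σ_h a_h(η_h) + Σ_h s_h(η_h, v_h, η_{h+1})` (`SlabChain.cost`; on the torus: `a_h` =
the plaquettes inside layer `h`, `s_h` = the lateral plaquettes of slab `h`).
* `SlabChain n E V` — the data `a`, `s`; `SlabChain.Bounds` — measurability and uniform bounds;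
* `SlabChain.kernel μV β h e e' = ∫ exp(β s_h(e, w, e')) dμV(w)` — the TRANSFER KERNEL of slab `h`;
  `kernelProd`, `layerWeight` (`exp(β Σ_h a_h(η_h))`);
* **`tilt_eq_integral_kernelProd`** — integrating out the vertical variables: for `F` a function of
  the layers only, `∫ F e^{βC} d(ν_E ⊗ ν_V) = ∫ F(η) e^{β Σ a_h(η_h)} ∏_h K_h(η_h, η_{h+1}) dν_E(η)`
  (Fubini and `integral_fintype_prod_eq_prod`);
* `SlabChain.Moments μV g c ρ` — the MOMENT HYPOTHESIS: `∫ s_h(e,w,e')^m dμV(w) = c_{h,m}` is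
  CONSTANT in `(e, e')` for `m < g` and `= c_{h,g} + g!·ρ_h(e,e')` for `m = g`;
* **`kernel_unifO`** — then `K_h(β; e, e') = cpoly_h(β) + β^g ρ_h(e,e') + O(β^{g+1})` UNIFORMLY in
  `(e, e')` (`UnifO (g+1)`), with the scalar polynomial `cpoly c g h β = Σ_{m ≤ g} βᵐ c_{h,m}/m!`
  (Taylor's theorem for `exp` with Mathlib's remainder `Complex.norm_exp_sub_sum_le_norm_mul_exp`,
  integrated); `norm_kernel_le`, `measurable_kernel`, `cpoly_zero`.
For `U(1)` (sequel files) `g = 4` and `ρ_h` is a character sum over closed words of four lateral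
plaquettes.  Elementary; nothing is cited as a fact; `def`s `SlabChain` (structure), `cost`,
`layerWeight`, `kernel`, `kernelProd`, `cpoly`; no `sorry`.
-/

noncomputable section

open MeasureTheory Filter Topology Asymptotics Finset
open scoped Nat
open Literature.MathematicalPhysics.QuantumFieldTheory (JetEq BddAt)
open Summit.Ventures.LatticeQCDFlow.Theory2.Tilted

namespace Summit.Ventures.LatticeQCDFlow.Theory2

/-- **A slab chain**: in-layer costs `a h : E → ℝ` and slab costs `s h : E → V → E → ℝ` on
`L = n+1` cyclic heights. [folklore] -/
structure SlabChain (n : ℕ) (E V : Type*) where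
  /-- the in-layer cost at height `h` -/
  a : Fin (n + 1) → E → ℝ
  /-- the cost of slab `h`, a function of `(η_h, v_h, η_{h+1})` -/
  s : Fin (n + 1) → E → V → E → ℝ

namespace SlabChain

variable {n : ℕ} {E V : Type*} [MeasurableSpace E] [MeasurableSpace V]

/-- The total cost `C(η, v) = Σ_h a_h(η_h) + Σ_h s_h(η_h, v_h, η_{h+1})`. [folklore] -/
def cost (D : SlabChain n E V) (ω : (Fin (n + 1) → E) × (Fin (n + 1) → V)) : ℝ :=
  ∑ h, D.a h (ω.1 h) + ∑ h, D.s h (ω.1 h) (ω.2 h) (ω.1 (h + 1))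

/-- The in-layer weight `exp(β Σ_h a_h(η_h))`. [folklore] -/
def layerWeight (D : SlabChain n E V) (β : ℂ) (η : Fin (n + 1) → E) : ℂ :=
  Complex.exp (β * ((∑ h, D.a h (η h) : ℝ) : ℂ))

/-- **The transfer kernel of slab `h`**: `K_h(β; e, e') = ∫ exp(β s_h(e, w, e')) dμV(w)`. [folklore] -/
def kernel (D : SlabChain n E V) (μV : Measure V) (β : ℂ) (h : Fin (n + 1)) (e e' : E) : ℂ :=
  ∫ w, Complex.exp (β * ((D.s h e w e' : ℝ) : ℂ)) ∂μV

/-- The product of the transfer kernels along the chain, `∏_h K_h(η_h, η_{h+1})`. [folklore] -/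
def kernelProd (D : SlabChain n E V) (μV : Measure V) (β : ℂ) (η : Fin (n + 1) → E) : ℂ :=
  ∏ h, D.kernel μV β h (η h) (η (h + 1))

/-- Measurability and uniform bounds of a slab chain. [folklore] -/
structure Bounds (D : SlabChain n E V) (Ma Ms : ℝ) : Prop where
  /-- each in-layer cost is measurable -/
  a_meas : ∀ h, Measurable (D.a h)
  /-- each slab cost is jointly measurable -/
  s_meas : ∀ h, Measurable fun p : E × V × E => D.s h p.1 p.2.1 p.2.2
  /-- uniform bound on the in-layer costs -/
  a_bound : ∀ h e, |D.a h e| ≤ Ma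
  /-- uniform bound on the slab costs -/
  s_bound : ∀ h e w e', |D.s h e w e'| ≤ Ms
  /-- the bounds are non-negative -/
  Ma_nonneg : 0 ≤ Ma
  /-- the bounds are non-negative -/
  Ms_nonneg : 0 ≤ Ms

/-- **The moment hypothesis**: the vertical moments `∫ s_h(e,w,e')^m dμV(w)` are the constants
`c h m` for `m < g`, and `c h g + g!·ρ h e e'` for `m = g`. [folklore] -/
structure Moments (D : SlabChain n E V) (μV : Measure V) (g : ℕ) (c : Fin (n + 1) → ℕ → ℂ)
    (ρ : Fin (n + 1) → E → E → ℂ) : Prop where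
  /-- the low moments are constant -/
  low : ∀ h, ∀ m < g, ∀ e e', ∫ w, ((D.s h e w e' : ℝ) : ℂ) ^ m ∂μV = c h m
  /-- the moment of order `g` -/
  top : ∀ h e e', ∫ w, ((D.s h e w e' : ℝ) : ℂ) ^ g ∂μV = c h g + (g ! : ℂ) * ρ h e e'

/-- The scalar Taylor polynomial of the kernel, `cpoly c g h β = Σ_{m ≤ g} βᵐ/m! · c_{h,m}`. [folklore] -/
def cpoly (c : Fin (n + 1) → ℕ → ℂ) (g : ℕ) (h : Fin (n + 1)) (β : ℂ) : ℂ :=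
  ∑ m ∈ range (g + 1), β ^ m / (m ! : ℂ) * c h m

section Basic

variable {D : SlabChain n E V} {Ma Ms : ℝ}

/-- The cost is measurable. [folklore] -/
theorem measurable_cost (hD : D.Bounds Ma Ms) : Measurable D.cost := by
  unfold cost
  refine (Finset.measurable_sum _ fun h _ => ?_).add (Finset.measurable_sum _ fun h _ => ?_)
  · exact (hD.a_meas h).comp ((measurable_pi_apply h).comp measurable_fst)
  · have hm : Measurable fun ω : (Fin (n + 1) → E) × (Fin (n + 1) → V) =>
        (ω.1 h, ω.2 h, ω.1 (h + 1)) :=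
      ((measurable_pi_apply h).comp measurable_fst).prodMk
        (((measurable_pi_apply h).comp measurable_snd).prodMk
          ((measurable_pi_apply (h + 1)).comp measurable_fst))
    exact (hD.s_meas h).comp hm

/-- The cost is bounded by `(n+1)(Ma + Ms)`. [folklore] -/
theorem abs_cost_le (hD : D.Bounds Ma Ms) (ω : (Fin (n + 1) → E) × (Fin (n + 1) → V)) :
    |D.cost ω| ≤ (n + 1) * (Ma + Ms) := by
  unfold cost
  refine (abs_add_le _ _).trans ?_
  have h1 : |∑ h, D.a h (ω.1 h)| ≤ (n + 1) * Ma := by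
    refine (Finset.abs_sum_le_sum_abs _ _).trans ?_
    calc ∑ h, |D.a h (ω.1 h)| ≤ ∑ _h : Fin (n + 1), Ma := sum_le_sum fun h _ => hD.a_bound h _
      _ = (n + 1) * Ma := by simp
  have h2 : |∑ h, D.s h (ω.1 h) (ω.2 h) (ω.1 (h + 1))| ≤ (n + 1) * Ms := by
    refine (Finset.abs_sum_le_sum_abs _ _).trans ?_
    calc ∑ h, |D.s h (ω.1 h) (ω.2 h) (ω.1 (h + 1))| ≤ ∑ _h : Fin (n + 1), Ms :=
          sum_le_sum fun h _ => hD.s_bound h _ _ _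
      _ = (n + 1) * Ms := by simp
  linarith

/-- The slab cost with frozen layer arguments is measurable in the vertical variable. [folklore] -/
theorem measurable_s_mid (hD : D.Bounds Ma Ms) (h : Fin (n + 1)) (e e' : E) :
    Measurable fun w => D.s h e w e' :=
  (hD.s_meas h).comp (measurable_const.prodMk (measurable_id.prodMk measurable_const))

/-- The exponential integrand of the kernel is jointly measurable. [folklore] -/
theorem measurable_kernelIntegrand (hD : D.Bounds Ma Ms) (β : ℂ) (h : Fin (n + 1)) :
    Measurable fun q : (E × E) × V => Complex.exp (β * ((D.s h q.1.1 q.2 q.1.2 : ℝ) : ℂ)) := by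
  have hm : Measurable fun q : (E × E) × V => (q.1.1, q.2, q.1.2) :=
    (measurable_fst.comp measurable_fst).prodMk
      (measurable_snd.prodMk (measurable_snd.comp measurable_fst))
  exact Complex.measurable_exp.comp
    ((Complex.measurable_ofReal.comp ((hD.s_meas h).comp hm)).const_mul β)

/-- **The kernel is jointly measurable in `(e, e')`.** [folklore] -/
theorem measurable_kernel (hD : D.Bounds Ma Ms) (μV : Measure V) [SFinite μV] (β : ℂ)
    (h : Fin (n + 1)) : Measurable fun p : E × E => D.kernel μV β h p.1 p.2 := by
  have hsm := (measurable_kernelIntegrand hD β h).stronglyMeasurable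
  exact (hsm.integral_prod_right' (ν := μV)).measurable

/-- Pointwise bound of the kernel integrand. [folklore] -/
theorem norm_exp_mul_s_le (hD : D.Bounds Ma Ms) (β : ℂ) (h : Fin (n + 1)) (e e' : E) (w : V) :
    ‖Complex.exp (β * ((D.s h e w e' : ℝ) : ℂ))‖ ≤ Real.exp (‖β‖ * Ms) := by
  rw [Complex.norm_exp]
  refine Real.exp_le_exp.2 ((Complex.re_le_norm _).trans ?_)
  rw [norm_mul, Complex.norm_real, Real.norm_eq_abs]
  exact mul_le_mul_of_nonneg_left (hD.s_bound h e w e') (norm_nonneg _)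

/-- **The kernel is bounded**: `‖K_h(β; e, e')‖ ≤ e^{‖β‖ Ms}`. [folklore] -/
theorem norm_kernel_le (hD : D.Bounds Ma Ms) (μV : Measure V) [IsProbabilityMeasure μV] (β : ℂ)
    (h : Fin (n + 1)) (e e' : E) : ‖D.kernel μV β h e e'‖ ≤ Real.exp (‖β‖ * Ms) := by
  unfold kernel
  have hI := norm_integral_le_of_norm_le_const (μ := μV)
    (Eventually.of_forall fun w => norm_exp_mul_s_le hD β h e e' w)
  simpa using hI

/-- The layer weight is bounded: `‖exp(β Σ a_h)‖ ≤ e^{‖β‖ (n+1) Ma}`. [folklore] -/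
theorem norm_layerWeight_le (hD : D.Bounds Ma Ms) (β : ℂ) (η : Fin (n + 1) → E) :
    ‖D.layerWeight β η‖ ≤ Real.exp (‖β‖ * ((n + 1) * Ma)) := by
  unfold layerWeight
  rw [Complex.norm_exp]
  refine Real.exp_le_exp.2 ((Complex.re_le_norm _).trans ?_)
  rw [norm_mul, Complex.norm_real, Real.norm_eq_abs]
  refine mul_le_mul_of_nonneg_left ?_ (norm_nonneg _)
  refine (Finset.abs_sum_le_sum_abs _ _).trans ?_
  calc ∑ h, |D.a h (η h)| ≤ ∑ _h : Fin (n + 1), Ma := sum_le_sum fun h _ => hD.a_bound h _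
    _ = (n + 1) * Ma := by simp

/-- The layer weight is measurable. [folklore] -/
theorem measurable_layerWeight (hD : D.Bounds Ma Ms) (β : ℂ) : Measurable (D.layerWeight β) := by
  unfold layerWeight
  refine Complex.measurable_exp.comp ((Complex.measurable_ofReal.comp ?_).const_mul β)
  exact Finset.measurable_sum _ fun h _ => (hD.a_meas h).comp (measurable_pi_apply h)

/-- The kernel product is measurable. [folklore] -/
theorem measurable_kernelProd (hD : D.Bounds Ma Ms) (μV : Measure V) [SFinite μV] (β : ℂ) :
    Measurable (D.kernelProd μV β) := by
  unfold kernelProd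
  refine Finset.measurable_prod _ fun h _ => ?_
  have hm : Measurable fun η : Fin (n + 1) → E => (η h, η (h + 1)) :=
    (measurable_pi_apply h).prodMk (measurable_pi_apply (h + 1))
  exact (measurable_kernel hD μV β h).comp hm

/-- The kernel product is bounded. [folklore] -/
theorem norm_kernelProd_le (hD : D.Bounds Ma Ms) (μV : Measure V) [IsProbabilityMeasure μV]
    (β : ℂ) (η : Fin (n + 1) → E) :
    ‖D.kernelProd μV β η‖ ≤ Real.exp (‖β‖ * Ms) ^ (n + 1) := by
  unfold kernelProd
  rw [norm_prod]
  calc ∏ h, ‖D.kernel μV β h (η h) (η (h + 1))‖ ≤ ∏ _h : Fin (n + 1), Real.exp (‖β‖ * Ms) :=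
        prod_le_prod (fun _ _ => norm_nonneg _) fun h _ => norm_kernel_le hD μV β h _ _
    _ = Real.exp (‖β‖ * Ms) ^ (n + 1) := by simp

end Basic

/-! ## Integrating out the vertical variables -/

section Vertical

variable {D : SlabChain n E V} {Ma Ms : ℝ} (μ : Measure E) (μV : Measure V)
  [IsProbabilityMeasure μ] [IsProbabilityMeasure μV]

omit [MeasurableSpace E] in
/-- The vertical integral of the slab weights factorises over the slabs:
`∫ exp(β Σ_h s_h(η_h, v_h, η_{h+1})) dν_V(v) = ∏_h K_h(η_h, η_{h+1})`. [folklore] -/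
theorem integral_exp_sum_s_eq_kernelProd (β : ℂ) (η : Fin (n + 1) → E) :
    ∫ v, Complex.exp (β * ((∑ h, D.s h (η h) (v h) (η (h + 1)) : ℝ) : ℂ))
        ∂(Measure.pi fun _ : Fin (n + 1) => μV) = D.kernelProd μV β η := by
  have hexp : ∀ v : Fin (n + 1) → V,
      Complex.exp (β * ((∑ h, D.s h (η h) (v h) (η (h + 1)) : ℝ) : ℂ)) =
        ∏ h, Complex.exp (β * ((D.s h (η h) (v h) (η (h + 1)) : ℝ) : ℂ)) := by
    intro v
    rw [← Complex.exp_sum]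
    push_cast
    rw [Finset.mul_sum]
  simp_rw [hexp]
  exact integral_fintype_prod_eq_prod
    (fun h w => Complex.exp (β * ((D.s h (η h) w (η (h + 1)) : ℝ) : ℂ)))

/-- **Integrating out the vertical variables.**  For an observable `F` of the layers only,
`∫ F(η) e^{β C(η,v)} d(ν_E ⊗ ν_V) = ∫ F(η) · e^{β Σ_h a_h(η_h)} · ∏_h K_h(β; η_h, η_{h+1}) dν_E(η)`.
[folklore] -/
theorem tilt_eq_integral_kernelProd (hD : D.Bounds Ma Ms) {F : (Fin (n + 1) → E) → ℂ}
    (hFm : Measurable F) {K : ℝ} (hFb : ∀ η, ‖F η‖ ≤ K) (β : ℂ) :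
    tilt ((Measure.pi fun _ : Fin (n + 1) => μ).prod (Measure.pi fun _ : Fin (n + 1) => μV))
        D.cost (fun ω => F ω.1) β =
      ∫ η, F η * D.layerWeight β η * D.kernelProd μV β η ∂(Measure.pi fun _ : Fin (n + 1) => μ) := by
  set νE := Measure.pi fun _ : Fin (n + 1) => μ with hνE
  set νV := Measure.pi fun _ : Fin (n + 1) => μV with hνV
  have hK : 0 ≤ K := (norm_nonneg _).trans (hFb fun _ => Classical.choice (by
    by_contra hE
    rw [not_nonempty_iff] at hE
    have := IsProbabilityMeasure.measure_univ (μ := μ)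
    rw [Set.univ_eq_empty_iff.2 hE, measure_empty] at this
    exact zero_ne_one this))
  -- the integrand on the product and its integrability
  set G : (Fin (n + 1) → E) × (Fin (n + 1) → V) → ℂ :=
    fun ω => F ω.1 * Complex.exp (β * ((D.cost ω : ℝ) : ℂ)) with hG
  have hGm : Measurable G :=
    (hFm.comp measurable_fst).mul (Complex.measurable_exp.comp
      ((Complex.measurable_ofReal.comp (measurable_cost hD)).const_mul β))
  have hGb : ∀ ω, ‖G ω‖ ≤ K * Real.exp (‖β‖ * ((n + 1) * (Ma + Ms))) := by
    intro ω
    rw [hG, norm_mul]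
    refine mul_le_mul (hFb _) ?_ (norm_nonneg _) hK
    rw [Complex.norm_exp]
    refine Real.exp_le_exp.2 ((Complex.re_le_norm _).trans ?_)
    rw [norm_mul, Complex.norm_real, Real.norm_eq_abs]
    exact mul_le_mul_of_nonneg_left (abs_cost_le hD ω) (norm_nonneg _)
  have hGi : Integrable G (νE.prod νV) :=
    Integrable.of_bound hGm.aestronglyMeasurable _ (Eventually.of_forall hGb)
  -- Fubini
  have h1 : tilt (νE.prod νV) D.cost (fun ω => F ω.1) β = ∫ ω, G ω ∂(νE.prod νV) := rfl
  rw [h1, integral_prod G hGi]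
  refine integral_congr_ae (Eventually.of_forall fun η => ?_)
  -- the inner integral
  have hsplit : ∀ v : Fin (n + 1) → V, G (η, v) =
      F η * D.layerWeight β η *
        Complex.exp (β * ((∑ h, D.s h (η h) (v h) (η (h + 1)) : ℝ) : ℂ)) := by
    intro v
    simp only [hG, cost, layerWeight]
    push_cast
    rw [mul_add, Complex.exp_add, mul_assoc]
  simp_rw [hsplit]
  rw [integral_const_mul, integral_exp_sum_s_eq_kernelProd μV β η]

end Vertical

/-! ## The Taylor structure of the kernel under the moment hypothesis -/

section Taylor

variable {D : SlabChain n E V} {Ma Ms : ℝ} (μV : Measure V) [IsProbabilityMeasure μV]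
  {g : ℕ} {c : Fin (n + 1) → ℕ → ℂ} {ρ : Fin (n + 1) → E → E → ℂ}

omit [MeasurableSpace E] in
/-- `c h 0 = 1` (the zeroth moment of a probability measure), for `g ≥ 1`. [folklore] -/
theorem c_zero_eq_one (hM : D.Moments μV g c ρ) (hg : 1 ≤ g) (h : Fin (n + 1)) (e e' : E) :
    c h 0 = 1 := by
  have h0 := hM.low h 0 (by omega) e e'
  simpa using h0.symm

/-- `cpoly c g h 0 = c h 0`. [folklore] -/
theorem cpoly_zero (c : Fin (n + 1) → ℕ → ℂ) (g : ℕ) (h : Fin (n + 1)) : cpoly c g h 0 = c h 0 := by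
  unfold cpoly
  rw [Finset.sum_eq_single 0]
  · simp
  · intro m _ hm
    simp [zero_pow hm]
  · intro h0
    exact absurd (Finset.mem_range.2 (Nat.succ_pos g)) h0

/-- The scalar polynomial is continuous. [folklore] -/
theorem continuous_cpoly (c : Fin (n + 1) → ℕ → ℂ) (g : ℕ) (h : Fin (n + 1)) :
    Continuous (cpoly c g h) := by
  unfold cpoly
  fun_prop

/-- The scalar polynomial is bounded near `0`. [folklore] -/
theorem bddAt_cpoly (c : Fin (n + 1) → ℕ → ℂ) (g : ℕ) (h : Fin (n + 1)) : BddAt (cpoly c g h) :=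
  bddAt_of_continuous (continuous_cpoly c g h)

/-- `cpoly(β) − cpoly(0) = O(β)`. [folklore] -/
theorem cpoly_sub_isBigO (c : Fin (n + 1) → ℕ → ℂ) (g : ℕ) (h : Fin (n + 1)) :
    (fun β => cpoly c g h β - cpoly c g h 0) =O[𝓝 (0 : ℂ)] fun β => β ^ 1 := by
  have hd : Differentiable ℂ (cpoly c g h) := by
    unfold cpoly
    fun_prop
  have h1 := (hd 0).isBigO_sub
  simpa using h1

/-- **The Taylor structure of the transfer kernel.**  Under the bounds and the moment hypothesis,
`K_h(β; e, e') − cpoly_h(β) − β^g ρ_h(e, e') = O(β^{g+1})` UNIFORMLY in `(e, e')`. [folklore] -/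
theorem kernel_unifO (hD : D.Bounds Ma Ms) (hM : D.Moments μV g c ρ) (h : Fin (n + 1)) :
    UnifO (g + 1) (fun β (p : E × E) =>
      D.kernel μV β h p.1 p.2 - cpoly c g h β - β ^ g * ρ h p.1 p.2) := by
  refine ⟨Ms ^ (g + 1) * Real.exp Ms, 1, one_pos, fun β hβ p => ?_⟩
  obtain ⟨e, e'⟩ := p
  -- notation
  set x : V → ℂ := fun w => β * ((D.s h e w e' : ℝ) : ℂ) with hx
  have hxm : Measurable x :=
    (Complex.measurable_ofReal.comp (measurable_s_mid hD h e e')).const_mul β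
  have hxb : ∀ w, ‖x w‖ ≤ ‖β‖ * Ms := fun w => by
    rw [hx, norm_mul, Complex.norm_real, Real.norm_eq_abs]
    exact mul_le_mul_of_nonneg_left (hD.s_bound h e w e') (norm_nonneg _)
  have hβMs : ‖β‖ * Ms ≤ Ms := by
    calc ‖β‖ * Ms ≤ 1 * Ms := mul_le_mul_of_nonneg_right hβ.le hD.Ms_nonneg
      _ = Ms := one_mul Ms
  -- each Taylor term is integrable, and so is the exponential
  have hterm : ∀ m : ℕ, Integrable (fun w => x w ^ m / (m ! : ℂ)) μV := fun m =>
    Integrable.of_bound ((hxm.pow_const m).div_const _).aestronglyMeasurable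
      ((‖β‖ * Ms) ^ m / (m ! : ℝ)) (Eventually.of_forall fun w => by
        rw [norm_div, norm_pow, Complex.norm_natCast]
        gcongr
        exact hxb w)
  have hexpI : Integrable (fun w => Complex.exp (x w)) μV :=
    Integrable.of_bound (Complex.measurable_exp.comp hxm).aestronglyMeasurable
      (Real.exp (‖β‖ * Ms)) (Eventually.of_forall fun w => norm_exp_mul_s_le hD β h e e' w)
  -- the Taylor polynomial integrates to `cpoly + β^g ρ`
  have hpoly : ∫ w, ∑ m ∈ range (g + 1), x w ^ m / (m ! : ℂ) ∂μV =
      cpoly c g h β + β ^ g * ρ h e e' := by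
    rw [integral_finsetSum _ fun m _ => hterm m]
    have hm : ∀ m ∈ range (g + 1), ∫ w, x w ^ m / (m ! : ℂ) ∂μV =
        β ^ m / (m ! : ℂ) * ∫ w, ((D.s h e w e' : ℝ) : ℂ) ^ m ∂μV := by
      intro m _
      rw [← integral_const_mul]
      refine integral_congr_ae (Eventually.of_forall fun w => ?_)
      simp only [hx, mul_pow]
      ring
    rw [sum_congr rfl hm, Finset.sum_range_succ, cpoly, Finset.sum_range_succ, hM.top h e e']
    have hlow : ∑ m ∈ range g, β ^ m / (m ! : ℂ) * ∫ w, ((D.s h e w e' : ℝ) : ℂ) ^ m ∂μV =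
        ∑ m ∈ range g, β ^ m / (m ! : ℂ) * c h m :=
      sum_congr rfl fun m hm' => by rw [hM.low h m (mem_range.1 hm') e e']
    rw [hlow]
    have hg0 : (g ! : ℂ) ≠ 0 := by exact_mod_cast Nat.factorial_ne_zero g
    field_simp
    ring
  -- the remainder
  have hrem : D.kernel μV β h e e' - cpoly c g h β - β ^ g * ρ h e e' =
      ∫ w, (Complex.exp (x w) - ∑ m ∈ range (g + 1), x w ^ m / (m ! : ℂ)) ∂μV := by
    rw [integral_sub hexpI (integrable_finsetSum _ fun m _ => hterm m), hpoly, kernel]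
    ring
  have hpt : ∀ w, ‖Complex.exp (x w) - ∑ m ∈ range (g + 1), x w ^ m / (m ! : ℂ)‖ ≤
      Ms ^ (g + 1) * Real.exp Ms * ‖β‖ ^ (g + 1) := by
    intro w
    refine (Complex.norm_exp_sub_sum_le_norm_mul_exp (x w) (g + 1)).trans ?_
    have h1 : ‖x w‖ ^ (g + 1) ≤ (‖β‖ * Ms) ^ (g + 1) :=
      pow_le_pow_left₀ (norm_nonneg _) (hxb w) _
    have h2 : Real.exp ‖x w‖ ≤ Real.exp Ms := Real.exp_le_exp.2 ((hxb w).trans hβMs)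
    calc ‖x w‖ ^ (g + 1) * Real.exp ‖x w‖ ≤ (‖β‖ * Ms) ^ (g + 1) * Real.exp Ms :=
          mul_le_mul h1 h2 (Real.exp_pos _).le
            (pow_nonneg (mul_nonneg (norm_nonneg _) hD.Ms_nonneg) _)
      _ = Ms ^ (g + 1) * Real.exp Ms * ‖β‖ ^ (g + 1) := by ring
  show ‖D.kernel μV β h e e' - cpoly c g h β - β ^ g * ρ h e e'‖ ≤
    Ms ^ (g + 1) * Real.exp Ms * ‖β‖ ^ (g + 1)
  rw [hrem]
  have hI := norm_integral_le_of_norm_le_const (μ := μV) (Eventually.of_forall hpt)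
  simpa using hI

end Taylor

end SlabChain

end Summit.Ventures.LatticeQCDFlow.Theory2

end
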